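import Summits.HodgeConjecture.CorCM.CyclotomicTwoPowerPCyclicNormDescent
import Summits.HodgeConjecture.CorCM.CyclotomicTwoPowerPResidueField
import Summits.HodgeConjecture.CorCM.CyclotomicTwoPowerPNormObstruction
import Mathlib.FieldTheory.IntermediateField.Adjoin.Basic
import Mathlib.RingTheory.Localization.Integral
import HarnessLib

/-!
# `ω^{2^{j−1}}` is not a norm of degree `2^j` from `ℚ(ζ_{2^{a+1}p})` to the fixed field of `ζ ↦ ζ^e`
# (`e ≡ 1 (mod 2^{a+1})`, `e ≡ r (mod p)`, `r^{2^j} ≡ 1`), whenever `2^{a+1} ∣ p^f − 1`, `2^{a+2} ∤ p^f − 1`, `j ≤ a + 1` — inside `ℂ`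

COR-CM (cell `pub-hodgecm2`), binder seat b04 (gen 27), count-neutral — the `2^j`-SHEET PROGRAMME (A7-JUNCTION gen-26 addendum
§C, road map (iv), packaging; it subsumes the unfiled gen-26 draft for `j = 2`).  The
descent `CorCM/CyclotomicTwoPowerPCyclicNormDescent.descent_pow` is restated for the subfield `M = ℚ(ζ_{2^{a+1}p}) ⊆ ℂ` with
the ENDOMORPHISM `ρ : M → M`, `ζ ↦ ζ^e` (so that `ρ` can be iterated; `ρ^{2^j} = 1`): `ρ` fixes `μ_{2^{a+1}}`, acts on `μ_p` by
`z ↦ z^r`, and for every `w ∈ M`, every primitive `2^{a+1}`-th root of unity `ω` (`ω^{2^a} = −1`) and every `t`: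
**`∏_{i<2^j} ρ^i(w) ≠ ω^{2^{j−1}(2t+1)}`**.  Combined with `CorCM/SemilinearKernelNormCyclic` (a singular `2^j`-sheet block forces
`ω₀^{−d}`, `0 < d < 2^j`, hence — `d = 2^s d'`, `d'` odd, `w ↦ w^{2^{j−1−s}}` — some `ω^{2^{j−1} d'}` to be such a norm) and
`CorCM/CyclicSheetAnnihilator`, this is the arithmetic input for «`C_p ⋊_{2^j} C_{2^{a+j+1}}` GOOD».  KERNEL ONLY: theorems;
no definition, no named fact, no `sorry`.

* §1 `sigma_mk`, `exists_exp_of_pow` (CRT: `e ≡ 1 (2^{a+1})`, `e ≡ r (p)`, `e^{2^j} ≡ 1 (p)`, `e^{2^j} ≡ 1 (2^{a+1}p)`), `coprime_exp_of_pow`.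
* §2 **`exists_subfield_rho_pow`**.

## References

* [FeinGordonSmith1971] B. Fein, B. Gordon, J. H. Smith, J. Number Theory 3 (1971), 310–315.
* [Washington1997] L. C. Washington, *Introduction to Cyclotomic Fields*, Thm. 2.13.
* [Pierce1982] R. S. Pierce, *Associative Algebras*, GTM 88, Springer 1982, §15.1.
-/

noncomputable section

open Polynomial IntermediateField

namespace Summit.HodgeConjecture.CorCM.CyclotomicTwoPowerP.Cyclic

variable {p a : ℕ}

/-! ## §1 The exponent and the endomorphism `σ̃` on polynomials -/

/-- `σ̃(F mod Φ) = F(X^e) mod Φ` for the endomorphism `σ̃ : μ ↦ μ^e` of `Λ = ℤ[X]/(Φ_{2^{a+1}p})`. [folklore] -/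
theorem sigma_mk (hp : 0 < p) {e : ℕ} (hcop : e.Coprime (2 ^ (a + 1) * p)) (F : ℤ[X]) :
    AdjoinRoot.lift (algebraMap ℤ _) (AdjoinRoot.root (cyclotomic (2 ^ (a + 1) * p) ℤ) ^ e)
        (eval₂_root_pow_cyclotomic hp hcop) (AdjoinRoot.mk (cyclotomic (2 ^ (a + 1) * p) ℤ) F) =
      AdjoinRoot.mk (cyclotomic (2 ^ (a + 1) * p) ℤ) (F.comp (X ^ e)) := by
  rw [AdjoinRoot.lift_mk, ← AdjoinRoot.aeval_eq, aeval_comp, aeval_X_pow, aeval_def]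

/-- **CRT exponent**: `e ≡ 1 (mod 2^{a+1})`, `e ≡ r (mod p)`; if `r^n ≡ 1 (mod p)` then `e^n ≡ 1 (mod p)` and
`e^n ≡ 1 (mod 2^{a+1} p)`. [folklore] -/
theorem exists_exp_of_pow (hp : p.Prime) (hp2 : p ≠ 2) {n : ℕ} (r : ℕ) (hr : r ^ n % p = 1) :
    ∃ e : ℕ, e % 2 ^ (a + 1) = 1 ∧ e % p = r % p ∧ e ^ n % p = 1 ∧ e ^ n ≡ 1 [MOD 2 ^ (a + 1) * p] := by
  have hco : (2 ^ (a + 1)).Coprime p :=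
    Nat.Coprime.pow_left _ ((Nat.coprime_primes Nat.prime_two hp).2 hp2.symm)
  obtain ⟨e, he1, he2⟩ := Nat.chineseRemainder hco 1 r
  have h1 : e % 2 ^ (a + 1) = 1 := by
    have h : e % 2 ^ (a + 1) = 1 % 2 ^ (a + 1) := he1
    rw [h]; exact Nat.mod_eq_of_lt (Nat.one_lt_pow (Nat.succ_ne_zero a) (by norm_num : 1 < 2))
  have h2 : e % p = r % p := he2
  have h3 : e ^ n % p = 1 := by rw [Nat.pow_mod, h2, ← Nat.pow_mod, hr]
  refine ⟨e, h1, h2, h3, (Nat.modEq_and_modEq_iff_modEq_mul hco).1 ⟨?_, ?_⟩⟩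
  · have h4 : e ≡ 1 [MOD 2 ^ (a + 1)] := by
      rw [Nat.ModEq, h1, Nat.mod_eq_of_lt (Nat.one_lt_two_pow (Nat.succ_ne_zero a))]
    simpa using h4.pow n
  · rw [Nat.ModEq, h3, Nat.mod_eq_of_lt hp.one_lt]

/-- `gcd(e, 2^{a+1}p) = 1` when `e ≡ 1 (mod 2^{a+1})` and `e^n ≡ 1 (mod p)`, `n ≥ 1`. [folklore] -/
theorem coprime_exp_of_pow (hp : p.Prime) {e n : ℕ} (hn : 0 < n) (he : e % 2 ^ (a + 1) = 1) (hen : e ^ n % p = 1) :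
    e.Coprime (2 ^ (a + 1) * p) := by
  refine Nat.Coprime.mul_right (Nat.Coprime.pow_right _ (Nat.coprime_two_right.2 (Residue.odd_exp he))) ?_
  refine Nat.Coprime.symm ((Nat.Prime.coprime_iff_not_dvd hp).2 fun h => ?_)
  have h2 : p ∣ e ^ n := dvd_pow h hn.ne'
  rw [Nat.dvd_iff_mod_eq_zero] at h2
  omega

/-! ## §2 The subfield `ℚ(ζ_{2^{a+1}p})` and the endomorphism `ρ : ζ ↦ ζ^e` of order dividing `2^j` -/

/-- **THE DEGREE-`2^j` NORM OBSTRUCTION.**  `p` prime, `1 ≤ j ≤ a + 1`, `2^{a+1} ∣ p^f − 1`, `2^{a+2} ∤ p^f − 1`,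
`r^{2^j} ≡ 1 (mod p)`.  With `M = ℚ(ζ_{2^{a+1}p}) ⊆ ℂ` and `ρ : M → M`, `ζ ↦ ζ^e` (`e ≡ 1 (2^{a+1})`, `e ≡ r (p)`): `M ⊇ μ_{2^{a+1}p}`,
`ρ` fixes `μ_{2^{a+1}}`, `ρ(z) = z^r` for `z^p = 1`, `ρ^{2^j} = 1`, and `∏_{i<2^j} ρ^i(w) ≠ ω^{2^{j−1}(2t+1)}` for every `w ∈ M`, every
`ω` with `ω^{2^a} = −1` and every `t`. [cite: FeinGordonSmith1971, pp. 310–315] [cite: Pierce1982, §15.1] -/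
theorem exists_subfield_rho_pow (hp : p.Prime) {j : ℕ} (hj1 : 1 ≤ j) (hja : j ≤ a + 1) {f : ℕ}
    (hf1 : 2 ^ (a + 1) ∣ p ^ f - 1) (hf2 : ¬ 2 ^ (a + 2) ∣ p ^ f - 1) (r : ℕ) (hr : r ^ 2 ^ j % p = 1) :
    ∃ (M : Subfield ℂ) (ρ : M →+* M), (∀ z : ℂ, z ^ (2 ^ (a + 1) * p) = 1 → z ∈ M) ∧
      (∀ z : M, (z : ℂ) ^ 2 ^ (a + 1) = 1 → ρ z = z) ∧ (∀ z : M, (z : ℂ) ^ p = 1 → ρ z = z ^ r) ∧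
      (∀ z : M, ρ^[2 ^ j] z = z) ∧
      (∀ (w : M) (ω : ℂ), ω ^ 2 ^ a = -1 → ∀ t : ℕ,
        ((∏ i ∈ Finset.range (2 ^ j), ρ^[i] w : M) : ℂ) ≠ ω ^ (2 ^ (j - 1) * (2 * t + 1))) := by
  classical
  -- `p` is odd: `2^{a+1} ∣ p^f − 1`
  have hp2 : p ≠ 2 := by
    rintro rfl
    have h2 : (2 : ℕ) ∣ 2 ^ (a + 1) := dvd_pow_self 2 (Nat.succ_ne_zero a)
    have h3 : 2 ∣ 2 ^ f - 1 := h2.trans hf1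
    rcases Nat.eq_zero_or_pos f with hf | hf
    · subst hf; simp at hf2
    · have h4 : 2 ∣ 2 ^ f := dvd_pow_self 2 hf.ne'
      have h5 : 1 ≤ 2 ^ f := Nat.one_le_two_pow
      have : 2 ∣ 2 ^ f - (2 ^ f - 1) := Nat.dvd_sub h4 h3
      rw [Nat.sub_sub_self h5] at this
      exact absurd this (by norm_num)
  haveI : Fact p.Prime := ⟨hp⟩
  have hp0 : 0 < p := hp.pos
  have hn : 0 < 2 ^ j := by positivity
  haveI : NeZero (2 ^ (a + 1) * p) := ⟨by positivity⟩
  obtain ⟨e, he, hep, hen, heN⟩ := exists_exp_of_pow (a := a) hp hp2 r hr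
  obtain ⟨s, hs, hk⟩ := Residue.exists_residue (a := a) hp2 hf1 hf2
  have hecop := coprime_exp_of_pow (a := a) hp hn he hen
  have hdm := Nat.div_add_mod e (2 ^ (a + 1))
  rw [he] at hdm
  set q := e / 2 ^ (a + 1) with hq_def
  have hζ := Complex.isPrimitiveRoot_exp (2 ^ (a + 1) * p) (by positivity)
  set ζ := Complex.exp (2 * Real.pi * Complex.I / (2 ^ (a + 1) * p : ℕ)) with hζ_def
  have hζmod : ∀ x y : ℕ, x ≡ y [MOD 2 ^ (a + 1) * p] → ζ ^ x = ζ ^ y := fun x y h => by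
    rw [← pow_mod_orderOf ζ x, ← pow_mod_orderOf ζ y, ← hζ.eq_orderOf]
    exact congrArg (ζ ^ ·) h
  have hζint : IsIntegral ℚ ζ := (hζ.isIntegral (by positivity)).tower_top
  have hmem : ∀ m : ℕ, ζ ^ m ∈ ℚ⟮ζ⟯ := fun m => pow_mem (mem_adjoin_simple_self ℚ ζ) m
  -- the power basis of `ℚ⟮ζ⟯` and the endomorphism `ρ₀ : ζ ↦ ζ^e`
  set pb := IntermediateField.adjoin.powerBasis hζint with hpb_def
  have hgen : pb.gen = AdjoinSimple.gen ℚ ζ := IntermediateField.adjoin.powerBasis_gen hζint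
  have hmin : minpoly ℚ pb.gen = cyclotomic (2 ^ (a + 1) * p) ℚ := by
    rw [hgen, cyclotomic_eq_minpoly_rat hζ (by positivity)]
    exact IntermediateField.minpoly_gen (F := ℚ) ζ
  have hρ₀C : aeval (ζ ^ e) (minpoly ℚ pb.gen) = 0 := by
    rw [hmin, aeval_def, eval₂_eq_eval_map, map_cyclotomic, ← IsRoot.def, isRoot_cyclotomic_iff]
    exact hζ.pow_of_coprime _ hecop
  have hρ₀ : aeval (⟨ζ ^ e, hmem e⟩ : ℚ⟮ζ⟯) (minpoly ℚ pb.gen) = 0 := by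
    have h2 : (IntermediateField.val ℚ⟮ζ⟯) (aeval (⟨ζ ^ e, hmem e⟩ : ℚ⟮ζ⟯) (minpoly ℚ pb.gen)) = 0 := by
      rw [← Polynomial.aeval_algHom_apply]; exact hρ₀C
    exact (map_eq_zero_iff _ (IntermediateField.val ℚ⟮ζ⟯).toRingHom.injective).1 h2
  set ρ₀ : ℚ⟮ζ⟯ →ₐ[ℚ] ℚ⟮ζ⟯ := pb.lift (⟨ζ ^ e, hmem e⟩ : ℚ⟮ζ⟯) hρ₀ with hρ₀_def
  have hρ₀gen : ρ₀ (AdjoinSimple.gen ℚ ζ) = ⟨ζ ^ e, hmem e⟩ := by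
    have h := pb.lift_gen (⟨ζ ^ e, hmem e⟩ : ℚ⟮ζ⟯) hρ₀
    rw [hgen] at h
    exact h
  have hρ₀pow : ∀ m : ℕ, ρ₀ ⟨ζ ^ m, hmem m⟩ = ⟨ζ ^ (e * m), hmem (e * m)⟩ := fun m => by
    have h1 : (⟨ζ ^ m, hmem m⟩ : ℚ⟮ζ⟯) = AdjoinSimple.gen ℚ ζ ^ m := Subtype.ext (by simp [AdjoinSimple.coe_gen])
    rw [h1, map_pow, hρ₀gen]
    exact Subtype.ext (by simp [← pow_mul])
  have hρ₀it : ∀ (i m : ℕ), ρ₀^[i] ⟨ζ ^ m, hmem m⟩ = ⟨ζ ^ (e ^ i * m), hmem (e ^ i * m)⟩ := by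
    intro i
    induction i with
    | zero => intro m; exact Subtype.ext (by simp)
    | succ i ih =>
      intro m
      rw [Function.iterate_succ_apply, hρ₀pow, ih]
      exact Subtype.ext (by rw [show e ^ i * (e * m) = e ^ (i + 1) * m by ring])
  -- `ρ₀^{2^j} = id`: `e^{2^j} ≡ 1 (mod 2^{a+1} p)`
  have hρ₀alg : ∀ (i : ℕ) (g : ℚ[X]), ρ₀^[i] (aeval pb.gen g) = aeval (ρ₀^[i] pb.gen) g := by
    intro i
    induction i with
    | zero => intro g; rfl
    | succ i ih => intro g; rw [Function.iterate_succ_apply', Function.iterate_succ_apply', ih, ← Polynomial.aeval_algHom_apply]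
  have hρ₀n : ∀ z : ℚ⟮ζ⟯, ρ₀^[2 ^ j] z = z := by
    have hgen1 : (AdjoinSimple.gen ℚ ζ : ℚ⟮ζ⟯) = ⟨ζ ^ 1, hmem 1⟩ := Subtype.ext (by simp [AdjoinSimple.coe_gen])
    have hgn : ρ₀^[2 ^ j] pb.gen = pb.gen := by
      rw [hgen, hgen1, hρ₀it]
      refine Subtype.ext (hζmod _ _ ?_)
      rw [mul_one]
      exact heN
    intro z
    obtain ⟨g, rfl⟩ := pb.exists_eq_aeval' z
    have h := hρ₀alg (2 ^ j) g
    rw [hgn] at h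
    exact h
  refine ⟨ℚ⟮ζ⟯.toSubfield, ρ₀.toRingHom, fun z hz => ?_, fun z hz => ?_, fun z hz => ?_, fun z => hρ₀n z,
    fun w ω hω t hrel => ?_⟩
  · obtain ⟨m, -, rfl⟩ := hζ.eq_pow_of_pow_eq_one hz
    exact hmem m
  · -- `ρ` fixes the `2^{a+1}`-th roots of unity `ζ^m`, `p ∣ m`
    have hzn : (z : ℂ) ^ (2 ^ (a + 1) * p) = 1 := by rw [pow_mul, hz, one_pow]
    obtain ⟨m, -, hm⟩ := hζ.eq_pow_of_pow_eq_one hzn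
    have hzm : z = ⟨ζ ^ m, hmem m⟩ := Subtype.ext hm.symm
    have hpm : 2 ^ (a + 1) * p ∣ 2 ^ (a + 1) * m := hζ.dvd_of_pow_eq_one _ (by rw [mul_comm, pow_mul, hm, hz])
    obtain ⟨m', rfl⟩ : p ∣ m := Nat.dvd_of_mul_dvd_mul_left (by positivity) hpm
    rw [hzm, AlgHom.toRingHom_eq_coe, RingHom.coe_coe, hρ₀pow]
    apply Subtype.ext
    change ζ ^ (e * (p * m')) = ζ ^ (p * m')
    have harith : e * (p * m') = p * m' + (2 ^ (a + 1) * p) * (q * m') := by rw [← hdm]; ring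
    rw [harith, pow_add, show ζ ^ (2 ^ (a + 1) * p * (q * m')) = 1 by rw [pow_mul, hζ.pow_eq_one, one_pow], mul_one]
  · -- `ρ` acts on the `p`-th roots of unity `ζ^m`, `2^{a+1} ∣ m`, by `z ↦ z^r`
    have hzn : (z : ℂ) ^ (2 ^ (a + 1) * p) = 1 := by rw [mul_comm, pow_mul, hz, one_pow]
    obtain ⟨m, -, hm⟩ := hζ.eq_pow_of_pow_eq_one hzn
    have hzm : z = ⟨ζ ^ m, hmem m⟩ := Subtype.ext hm.symm
    have hpm : 2 ^ (a + 1) * p ∣ p * m := hζ.dvd_of_pow_eq_one _ (by rw [mul_comm, pow_mul, hm, hz])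
    obtain ⟨m', rfl⟩ : 2 ^ (a + 1) ∣ m :=
      Nat.dvd_of_mul_dvd_mul_left hp0 (by rw [mul_comm (2 ^ (a + 1)) p] at hpm; exact hpm)
    rw [hzm, AlgHom.toRingHom_eq_coe, RingHom.coe_coe, hρ₀pow]
    apply Subtype.ext
    change ζ ^ (e * (2 ^ (a + 1) * m')) = (ζ ^ (2 ^ (a + 1) * m')) ^ r
    rw [← pow_mul]
    refine hζmod _ _ ?_
    have h1 : e * m' ≡ r * m' [MOD p] := Nat.ModEq.mul_right _ hep
    have h2 := Nat.ModEq.mul_left' (2 ^ (a + 1)) h1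
    rw [show e * (2 ^ (a + 1) * m') = 2 ^ (a + 1) * (e * m') by ring,
      show 2 ^ (a + 1) * m' * r = 2 ^ (a + 1) * (r * m') by ring]
    exact h2
  · -- the norm obstruction
    obtain ⟨j₀, hj₀, hωj⟩ := eq_pow_odd_of_pow_eq_neg_one hp hp2 hω
    have ht₀ : Odd (j₀ * (2 * t + 1)) := hj₀.mul (odd_two_mul_add_one t)
    rw [← hζ_def] at hωj
    have hωpow : ω ^ (2 ^ (j - 1) * (2 * t + 1)) = ζ ^ (p * (2 ^ (j - 1) * (j₀ * (2 * t + 1)))) := by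
      rw [hωj, ← pow_mul]; congr 1; ring
    -- `w = f₁(ζ)`, `F = b f₁ ∈ ℤ[X]`
    have hwmem : (w : ℂ) ∈ Algebra.adjoin ℚ {ζ} := by
      rw [← adjoin_simple_toSubalgebra_of_isAlgebraic hζint.isAlgebraic]
      exact w.2
    rw [Algebra.adjoin_singleton_eq_range_aeval] at hwmem
    obtain ⟨f₁, hf⟩ := hwmem
    replace hf : aeval ζ f₁ = (w : ℂ) := hf
    obtain ⟨b, hb, hF⟩ := IsLocalization.integerNormalization_spec (nonZeroDivisors ℤ) f₁
    set F := IsLocalization.integerNormalization (nonZeroDivisors ℤ) f₁ with hF_def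
    have hb0 : b ≠ 0 := nonZeroDivisors.ne_zero hb
    have hFζ : ∀ x : ℂ, aeval x F = (b : ℂ) * aeval x f₁ := fun x => by
      rw [← aeval_map_algebraMap ℚ x F, hF, map_zsmul, zsmul_eq_mul]
    -- `ρ₀^i (w) = f₁(ζ^{e^i})`
    have hwgen : w = aeval (AdjoinSimple.gen ℚ ζ) f₁ := by
      apply Subtype.ext
      have h := IntermediateField.aeval_coe (S := ℚ⟮ζ⟯) (R := ℚ) (AdjoinSimple.gen ℚ ζ) f₁
      rw [AdjoinSimple.coe_gen] at h
      exact hf.symm.trans h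
    have hgenpow : ∀ m : ℕ, (⟨ζ ^ m, hmem m⟩ : ℚ⟮ζ⟯) = AdjoinSimple.gen ℚ ζ ^ m := fun m =>
      Subtype.ext (by simp [AdjoinSimple.coe_gen])
    have hρf : ∀ m : ℕ, ρ₀ (aeval (AdjoinSimple.gen ℚ ζ ^ m) f₁) = aeval (AdjoinSimple.gen ℚ ζ ^ (e * m)) f₁ := fun m => by
      rw [← aeval_algHom_apply, map_pow, hρ₀gen, hgenpow, ← pow_mul]
    have hcoe : ∀ m : ℕ, ((aeval (AdjoinSimple.gen ℚ ζ ^ m) f₁ : ℚ⟮ζ⟯) : ℂ) = aeval (ζ ^ m) f₁ := fun m => by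
      have h := (Polynomial.aeval_algHom_apply (IntermediateField.val ℚ⟮ζ⟯) (AdjoinSimple.gen ℚ ζ ^ m) f₁).symm
      refine h.trans ?_
      congr 1
    have hw0 : w = aeval (AdjoinSimple.gen ℚ ζ ^ 1) f₁ := by rw [pow_one]; exact hwgen
    have hρfit : ∀ i : ℕ, ρ₀^[i] w = aeval (AdjoinSimple.gen ℚ ζ ^ (e ^ i)) f₁ := by
      intro i
      induction i with
      | zero => rw [Function.iterate_zero, id, pow_zero]; exact hw0
      | succ i ih => rw [Function.iterate_succ_apply', ih, hρf, ← pow_succ']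
    have hv : ∀ i : ℕ, (((ρ₀^[i] w : ℚ⟮ζ⟯)) : ℂ) = aeval (ζ ^ (e ^ i)) f₁ := fun i => by rw [hρfit, hcoe]
    have hrel' : ∏ i ∈ Finset.range (2 ^ j), aeval (ζ ^ (e ^ i)) f₁ = ζ ^ (p * (2 ^ (j - 1) * (j₀ * (2 * t + 1)))) := by
      have hrel2 := hrel
      simp only [AlgHom.toRingHom_eq_coe, RingHom.coe_coe] at hrel2
      push_cast at hrel2
      rw [Finset.prod_congr rfl fun i _ => hv i, hωpow] at hrel2
      exact hrel2
    -- the relation in `Λ`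
    set n : ℕ := b.natAbs with hn_def
    have hn0 : 0 < n := Int.natAbs_pos.2 hb0
    have hev := lift_exp_injective (a := a) hp0
    set σt := AdjoinRoot.lift (algebraMap ℤ _) (AdjoinRoot.root (cyclotomic (2 ^ (a + 1) * p) ℤ) ^ e)
      (eval₂_root_pow_cyclotomic hp0 hecop) with hσt_def
    have hσt : σt (AdjoinRoot.root (cyclotomic (2 ^ (a + 1) * p) ℤ)) = AdjoinRoot.root (cyclotomic (2 ^ (a + 1) * p) ℤ) ^ e := by
      rw [hσt_def, AdjoinRoot.lift_root]
    have hevmk : ∀ G : ℤ[X], AdjoinRoot.lift (algebraMap ℤ ℂ) _ (eval₂_cyclotomic_exp (a := a) hp0)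
        (AdjoinRoot.mk (cyclotomic (2 ^ (a + 1) * p) ℤ) G) = aeval ζ G := lift_exp_mk hp0
    have hc1' : ∀ (x : ℂ) (G : ℤ[X]), aeval x (G.comp (X ^ e)) = aeval (x ^ e) G := fun x G => by
      rw [aeval_comp, aeval_X_pow]
    have hevit : ∀ (i : ℕ) (G : ℤ[X]), AdjoinRoot.lift (algebraMap ℤ ℂ) _ (eval₂_cyclotomic_exp (a := a) hp0)
        (σt^[i] (AdjoinRoot.mk (cyclotomic (2 ^ (a + 1) * p) ℤ) G)) = aeval (ζ ^ (e ^ i)) G := by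
      intro i
      induction i with
      | zero => intro G; rw [Function.iterate_zero, id, pow_zero, pow_one, hevmk]
      | succ i ih =>
        intro G
        rw [Function.iterate_succ_apply, hσt_def, sigma_mk hp0 hecop, ← hσt_def, ih, hc1', ← pow_mul, ← pow_succ]
    have hrelΛ : ∏ i ∈ Finset.range (2 ^ j), σt^[i] (AdjoinRoot.mk (cyclotomic (2 ^ (a + 1) * p) ℤ) F) =
        (n : AdjoinRoot (cyclotomic (2 ^ (a + 1) * p) ℤ)) ^ 2 ^ j *
          (AdjoinRoot.root (cyclotomic (2 ^ (a + 1) * p) ℤ) ^ (p * (2 ^ (j - 1) * (j₀ * (2 * t + 1)))) * 1) := by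
      apply hev
      have hnj : ((n : ℕ) : ℂ) ^ 2 ^ j = (b : ℂ) ^ 2 ^ j := by
        have e2 := congrArg (Int.cast : ℤ → ℂ) (Int.natAbs_pow_two b)
        rw [Int.cast_pow, Int.cast_pow, Int.cast_natCast] at e2
        obtain ⟨j', rfl⟩ : ∃ j', j = j' + 1 := ⟨j - 1, by omega⟩
        rw [pow_succ', pow_mul, pow_mul, e2]
      rw [map_prod, Finset.prod_congr rfl fun i _ => hevit i F, map_mul, map_pow, map_natCast, map_mul, map_one, mul_one,
        map_pow, AdjoinRoot.lift_root, ← hζ_def, hnj, ← hrel']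
      simp_rw [hFζ]
      rw [Finset.prod_mul_distrib, Finset.prod_const, Finset.card_range]
    exact descent_pow hp hp2 hj1 hja he hen σt hσt
      (AdjoinRoot.lift (Int.castRingHom (GaloisField p f)) s (Residue.eval₂_cyclotomic_of_pow_eq hp hp2 hs))
      (by rw [AdjoinRoot.lift_root]) hs hk ht₀ n hn0 _ 1 1 one_ne_zero (by rw [map_one, one_pow]) hrelΛ

end Summit.HodgeConjecture.CorCM.CyclotomicTwoPowerP.Cyclic

end
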